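import Summits.ValiantsHypothesis.ValiantsHypothesis.Theorems.KPlusLogSqLawTropicalBStaticFourSignChecker
import Summits.ValiantsHypothesis.ValiantsHypothesis.Theorems.KPlusLogSqLawTropicalBDiagonalBracketing

/-!
# `TropicalB` (stmt-ValiantsHypothesis-19771) — the static `4 × 4` cell: INTERPRETATION of the sign checker
# (a static design and a set `V` of dominant permutations satisfy the conditions `condsOf V` with a transitive exchange vector)

Cell `pub-symmetroid`, seat val-sym-trop-p4 (g7).  HONEST FRAMING: the link between the tree's design vocabulary (`IsStatic`, `IsDominant`,
`tropWeight`, `termSign`) and the finite model of `…StaticFourSignCheckerDefs` / `…StaticFourSignChecker` (p524484 / p525054): for a STATIC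
`4 × 4` design and any set `V` of indices of permutations carried by dominant terms, the vector `e` of the `36` block exchanges of the cell
slopes `a r i = d (class at (r, i))` satisfies the `48` triple laws (`Trans e`) and every condition of `condsOf V` (`CondHolds e c`) —
`conds_hold`.  The geometric inputs are DIAGONAL BRACKETING and the `3 × 3` PARITY-CLASS LAW of `…TropicalBDiagonalBracketing` (p522470);
the combinatorial inputs (cell identities of the `18` quads and `16` blocks, cell coverage, the literal ↔ block-exchange dictionary, the
additivity behind the triple laws) are `decide`d table facts.  With `rep_contradiction` this refutes `16` dominant permutations forming an orbit
representative; the orbit cover and the assembly «a static `4 × 4` design has at most `15` dominant terms» are the next files.  Nothing here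
bears on `TropicalB` in its window, `WeakLifting`, `MatrixDescartes` (stmt-ValiantsHypothesis-18050) or VP ≠ VNP.
[this seat]
-/

set_option linter.dupNamespace false
set_option autoImplicit false

namespace Summit.ValiantsHypothesis.ValiantsHypothesis.Theorems.KPlusLogSqLaw.StaticFourQuad

open Summit.ValiantsHypothesis.ValiantsHypothesis.Theorems.MatrixDescartes.Negative
open Summit.ValiantsHypothesis.ValiantsHypothesis.Theorems.LacunarySymmetroidMatrixDescartes
open Summit.ValiantsHypothesis.ValiantsHypothesis.Theorems.LacunarySymmetroidMatrixDescartes.TropicalCensus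
open Finset

/-! ### 1. Cell indicators and the `decide`d table facts -/

/-- indicator of the cells `(rowOf s i, i)` of the permutation of index `s`. -/
def ind (s : Fin 24) (r i : Fin 4) : ℤ := if rowOf s i = r then 1 else 0

/-- signed indicator of block `b`: `+1` on its main diagonal `(r,i), (r',j)`, `−1` on its anti-diagonal `(r,j), (r',i)`. -/
def blkInd (b : Fin 36) (r i : Fin 4) : ℤ :=
  (if r = blkR b ∧ i = blkC b then 1 else 0) + (if r = blkR' b ∧ i = blkC' b then 1 else 0) -
    (if r = blkR b ∧ i = blkC' b then 1 else 0) - (if r = blkR' b ∧ i = blkC b then 1 else 0)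

/-- `+1` for a positive literal, `−1` for a negative one. -/
def litZ (l : Lit) : ℤ := if l.2 then 1 else -1

/-- the literal dictionary for the ordered pair `(s, t)`: `cells(t) − cells(s) = litZ · blkInd` (as cell functions). -/
def LitOK (s t : Fin 24) : Prop := ∀ r i, ind t r i - ind s r i = litZ (lit s t) * blkInd (lit s t).1 r i

/-- `LitOK s t` is a finite conjunction of integer identities, hence decidable (used by the `decide`d table facts below). -/
instance instDecidableLitOK (s t : Fin 24) : Decidable (LitOK s t) := by
  unfold LitOK; infer_instance

/-- the table `rowOf` is the table of values of `P24`. -/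
theorem rowOf_P24 : ∀ s i, rowOf s i = P24 s i := by decide +kernel

/-- `P24` is injective. -/
theorem P24_injective : ∀ s t : Fin 24, P24 s = P24 t → s = t := by decide +kernel

/-- facts about the `18` quads `(c₀, c₁, c₂, c₃)`: cell identity `c₀ + c₃ = c₁ + c₂`, every cell of a corner is a cell of a corner of the other
diagonal, the corners are pairwise different, and the literal dictionary for the `8 + 8` ordered adjacent pairs used by `diagCond`. -/
theorem quad_facts : ∀ q ∈ quadT,
    (∀ r i, ind q.1 r i + ind q.2.2.2 r i = ind q.2.1 r i + ind q.2.2.1 r i) ∧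
    (∀ i, (rowOf q.2.1 i = rowOf q.1 i ∨ rowOf q.2.1 i = rowOf q.2.2.2 i) ∧ (rowOf q.2.2.1 i = rowOf q.1 i ∨ rowOf q.2.2.1 i = rowOf q.2.2.2 i) ∧
      (rowOf q.1 i = rowOf q.2.1 i ∨ rowOf q.1 i = rowOf q.2.2.1 i) ∧ (rowOf q.2.2.2 i = rowOf q.2.1 i ∨ rowOf q.2.2.2 i = rowOf q.2.2.1 i)) ∧
    (q.1 ≠ q.2.1 ∧ q.1 ≠ q.2.2.1 ∧ q.1 ≠ q.2.2.2 ∧ q.2.1 ≠ q.2.2.1 ∧ q.2.1 ≠ q.2.2.2 ∧ q.2.2.1 ≠ q.2.2.2) ∧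
    (LitOK q.1 q.2.1 ∧ LitOK q.1 q.2.2.1 ∧ LitOK q.2.1 q.2.2.2 ∧ LitOK q.2.2.1 q.2.2.2 ∧
     LitOK q.2.2.2 q.2.1 ∧ LitOK q.2.2.2 q.2.2.1 ∧ LitOK q.2.1 q.1 ∧ LitOK q.2.2.1 q.1) := by
  decide +kernel

/-- facts about the `16` blocks `((e₁,e₂,e₃),(o₁,o₂,o₃))`: cell identity `Σ_E = Σ_O`, every cell of an `o` is a cell of some `e` and
conversely, the six are pairwise different, and the literal dictionary for the `9 + 9` ordered pairs `(e, o)`, `(o, e)`. -/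
theorem hex_facts : ∀ h ∈ hexT,
    (∀ r i, ind h.1.1 r i + ind h.1.2.1 r i + ind h.1.2.2 r i = ind h.2.1 r i + ind h.2.2.1 r i + ind h.2.2.2 r i) ∧
    (∀ i, (rowOf h.2.1 i = rowOf h.1.1 i ∨ rowOf h.2.1 i = rowOf h.1.2.1 i ∨ rowOf h.2.1 i = rowOf h.1.2.2 i) ∧
      (rowOf h.2.2.1 i = rowOf h.1.1 i ∨ rowOf h.2.2.1 i = rowOf h.1.2.1 i ∨ rowOf h.2.2.1 i = rowOf h.1.2.2 i) ∧
      (rowOf h.2.2.2 i = rowOf h.1.1 i ∨ rowOf h.2.2.2 i = rowOf h.1.2.1 i ∨ rowOf h.2.2.2 i = rowOf h.1.2.2 i) ∧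
      (rowOf h.1.1 i = rowOf h.2.1 i ∨ rowOf h.1.1 i = rowOf h.2.2.1 i ∨ rowOf h.1.1 i = rowOf h.2.2.2 i) ∧
      (rowOf h.1.2.1 i = rowOf h.2.1 i ∨ rowOf h.1.2.1 i = rowOf h.2.2.1 i ∨ rowOf h.1.2.1 i = rowOf h.2.2.2 i) ∧
      (rowOf h.1.2.2 i = rowOf h.2.1 i ∨ rowOf h.1.2.2 i = rowOf h.2.2.1 i ∨ rowOf h.1.2.2 i = rowOf h.2.2.2 i)) ∧
    (h.1.1 ≠ h.1.2.1 ∧ h.1.1 ≠ h.1.2.2 ∧ h.1.2.1 ≠ h.1.2.2 ∧ h.2.1 ≠ h.2.2.1 ∧ h.2.1 ≠ h.2.2.2 ∧ h.2.2.1 ≠ h.2.2.2 ∧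
     h.1.1 ≠ h.2.1 ∧ h.1.1 ≠ h.2.2.1 ∧ h.1.1 ≠ h.2.2.2 ∧ h.1.2.1 ≠ h.2.1 ∧ h.1.2.1 ≠ h.2.2.1 ∧ h.1.2.1 ≠ h.2.2.2 ∧
     h.1.2.2 ≠ h.2.1 ∧ h.1.2.2 ≠ h.2.2.1 ∧ h.1.2.2 ≠ h.2.2.2) ∧
    (LitOK h.1.1 h.2.1 ∧ LitOK h.1.1 h.2.2.1 ∧ LitOK h.1.1 h.2.2.2 ∧ LitOK h.1.2.1 h.2.1 ∧ LitOK h.1.2.1 h.2.2.1 ∧ LitOK h.1.2.1 h.2.2.2 ∧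
     LitOK h.1.2.2 h.2.1 ∧ LitOK h.1.2.2 h.2.2.1 ∧ LitOK h.1.2.2 h.2.2.2 ∧
     LitOK h.2.1 h.1.1 ∧ LitOK h.2.2.1 h.1.1 ∧ LitOK h.2.2.2 h.1.1 ∧ LitOK h.2.1 h.1.2.1 ∧ LitOK h.2.2.1 h.1.2.1 ∧ LitOK h.2.2.2 h.1.2.1 ∧
     LitOK h.2.1 h.1.2.2 ∧ LitOK h.2.2.1 h.1.2.2 ∧ LitOK h.2.2.2 h.1.2.2) := by
  decide +kernel

/-- additivity behind the triple laws (Boolean form, evaluated by the kernel). -/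
theorem triple_factsB : ((List.finRange 36).all fun b => (triplesOf b).all fun t =>
    (List.finRange 4).all fun r => (List.finRange 4).all fun i =>
      decide (blkInd t.1 r i + blkInd t.2.1 r i = blkInd t.2.2 r i)) = true := by
  decide +kernel

/-- additivity behind the triple laws: `blkInd b_uv + blkInd b_vw = blkInd b_uw` for every listed triple. -/
theorem triple_facts (b : Fin 36) (t : Fin 36 × Fin 36 × Fin 36) (ht : t ∈ triplesOf b) (r i : Fin 4) :
    blkInd t.1 r i + blkInd t.2.1 r i = blkInd t.2.2 r i := by
  have h := triple_factsB
  simp only [List.all_eq_true, List.mem_finRange, true_implies, decide_eq_true_eq] at h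
  exact h b t ht r i

/-! ### 2. Linear algebra of cells: slopes, block exchanges, literals, triple laws -/

/-- slope of the permutation of index `s` for cell slopes `a`. -/
def xv (a : Fin 4 → Fin 4 → ℤ) (s : Fin 24) : ℤ := ∑ i, a (rowOf s i) i

/-- block exchange `b` of the cell slopes `a`. -/
def ev (a : Fin 4 → Fin 4 → ℤ) (b : Fin 36) : ℤ := ∑ r, ∑ i, blkInd b r i * a r i

/-- a sum over the cells of a permutation is the indicator-weighted sum over all cells. -/
theorem sum_cells (F : Fin 4 → Fin 4 → ℤ) (s : Fin 24) : ∑ i, F (rowOf s i) i = ∑ r, ∑ i, ind s r i * F r i := by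
  rw [Finset.sum_comm]
  refine Finset.sum_congr rfl fun i _ => ?_
  unfold ind
  rw [Finset.sum_eq_single (rowOf s i)]
  · simp
  · intro r _ hr
    simp [Ne.symm hr]
  · intro h
    exact absurd (Finset.mem_univ _) h

/-- two-plus-two cell identities transfer to sums over cells. -/
theorem sum_cells_two (F : Fin 4 → Fin 4 → ℤ) {s t u w : Fin 24} (h : ∀ r i, ind s r i + ind t r i = ind u r i + ind w r i) :
    (∑ i, F (rowOf s i) i) + ∑ i, F (rowOf t i) i = (∑ i, F (rowOf u i) i) + ∑ i, F (rowOf w i) i := by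
  simp only [sum_cells, ← Finset.sum_add_distrib, ← add_mul, h]

/-- three-plus-three cell identities transfer to sums over cells. -/
theorem sum_cells_three (F : Fin 4 → Fin 4 → ℤ) {s t u s' t' u' : Fin 24}
    (h : ∀ r i, ind s r i + ind t r i + ind u r i = ind s' r i + ind t' r i + ind u' r i) :
    (∑ i, F (rowOf s i) i) + (∑ i, F (rowOf t i) i) + ∑ i, F (rowOf u i) i =
      (∑ i, F (rowOf s' i) i) + (∑ i, F (rowOf t' i) i) + ∑ i, F (rowOf u' i) i := by
  simp only [sum_cells, ← Finset.sum_add_distrib, ← add_mul, h]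

/-- the literal dictionary: `x_t − x_s = ± e_{block}`. -/
theorem lit_diff (a : Fin 4 → Fin 4 → ℤ) {s t : Fin 24} (h : LitOK s t) :
    xv a t - xv a s = litZ (lit s t) * ev a (lit s t).1 := by
  unfold xv ev
  rw [sum_cells a t, sum_cells a s, ← Finset.sum_sub_distrib, Finset.mul_sum]
  refine Finset.sum_congr rfl fun r _ => ?_
  rw [← Finset.sum_sub_distrib, Finset.mul_sum]
  refine Finset.sum_congr rfl fun i _ => ?_
  rw [← sub_mul, h r i, mul_assoc]

/-- the literal of `(s, t)` holds for the block exchanges of `a` as soon as `x_s < x_t`. -/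
theorem lit_holds (a : Fin 4 → Fin 4 → ℤ) {s t : Fin 24} (h : LitOK s t) (hlt : xv a s < xv a t) :
    LitHolds (ev a) (lit s t) := by
  have hd := lit_diff a h
  unfold LitHolds litZ at *
  constructor
  · intro h2; rw [h2] at hd; simp at hd; linarith
  · intro h2; rw [h2] at hd; simp at hd; linarith

/-- the block exchanges of any cell slopes satisfy the triple laws. -/
theorem trans_ev (a : Fin 4 → Fin 4 → ℤ) : Trans (ev a) := by
  intro b t ht
  have hadd : ev a t.1 + ev a t.2.1 = ev a t.2.2 := by
    unfold ev
    rw [← Finset.sum_add_distrib]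
    refine Finset.sum_congr rfl fun r _ => ?_
    rw [← Finset.sum_add_distrib]
    refine Finset.sum_congr rfl fun i _ => ?_
    rw [← add_mul, triple_facts b t ht r i]
  unfold TripleLaw
  constructor <;> intro h1 h2 <;> linarith

/-- a branch of listed literals holds when each listed literal holds. -/
theorem branchHolds_of {e : Fin 36 → ℤ} {ls : List Lit} (h : ∀ l ∈ ls, LitHolds e l) : BranchHolds e ls := h

/-! ### 3. Static designs: the term carried by a permutation -/

section Design

variable {K : ℕ} (d : Fin K → ℕ) (v ε : Fin 4 → Fin 4 → Fin K → ℤ)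

/-- the term on the permutation of index `s` whose classes are read off a class table `cls`. -/
def sterm (cls : Fin 4 → Fin 4 → Fin K) (s : Fin 24) : Equiv.Perm (Fin 4) × (Fin 4 → Fin K) :=
  (P24 s, fun i => cls (rowOf s i) i)

/-- cell slopes of a class table. -/
def aOf (cls : Fin 4 → Fin 4 → Fin K) (r i : Fin 4) : ℤ := (d (cls r i) : ℤ)

/-- cell values of a class table. -/
def yv (cls : Fin 4 → Fin 4 → Fin K) (s : Fin 24) : ℤ := ∑ i, v (rowOf s i) i (cls (rowOf s i) i)

variable (cls : Fin 4 → Fin 4 → Fin K)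

/-- the weight of `sterm cls s` is `θ·x_s − y_s`. -/
theorem sterm_weight (s : Fin 24) (θ : ℤ) : tropWeight d v θ (sterm cls s) = θ * xv (aOf d cls) s - yv v cls s := by
  unfold tropWeight sterm xv yv aOf
  simp only [← rowOf_P24]

/-- the slope of `sterm cls s` is `x_s`. -/
theorem sterm_slope (s : Fin 24) : TropicalCensus.slope d (sterm cls s) = xv (aOf d cls) s := by
  unfold TropicalCensus.slope sterm xv aOf
  simp only

/-- different indices give different terms. -/
theorem sterm_ne {s t : Fin 24} (h : s ≠ t) : sterm cls s ≠ sterm cls t :=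
  fun e => h (P24_injective s t (congrArg Prod.fst e))

variable {ε cls}

/-- with a class table hitting a present class wherever there is one, a permutation all of whose cells are present carries a present term. -/
theorem sterm_present (hcls : ∀ r i l, ε r i l ≠ 0 → ε r i (cls r i) ≠ 0) {s : Fin 24}
    (h : ∀ i, ∃ l, ε (rowOf s i) i l ≠ 0) : termSign ε (sterm cls s) ≠ 0 := by
  refine Bracketing.termSign_ne_zero_of_present ε _ fun i => ?_
  obtain ⟨l, hl⟩ := h i
  show ε (P24 s i) i (cls (rowOf s i) i) ≠ 0
  rw [← rowOf_P24]
  exact hcls _ _ _ hl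

/-- in a static design a present term on the permutation `P24 s` IS `sterm cls s`. -/
theorem eq_sterm (hs : IsStatic ε) (hcls : ∀ r i l, ε r i l ≠ 0 → ε r i (cls r i) ≠ 0)
    {q : Equiv.Perm (Fin 4) × (Fin 4 → Fin K)} (hq : termSign ε q ≠ 0) {s : Fin 24} (h1 : q.1 = P24 s) : q = sterm cls s := by
  refine Prod.ext h1 (funext fun i => ?_)
  have hp := present_of_termSign_ne_zero ε q hq i
  rw [h1] at hp
  have hc := hcls _ _ _ hp
  show q.2 i = cls (rowOf s i) i
  rw [rowOf_P24]
  exact hs _ _ _ _ hp hc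

/-- the cells of a present term are present. -/
theorem cells_present {q : Equiv.Perm (Fin 4) × (Fin 4 → Fin K)} (hq : termSign ε q ≠ 0) {s : Fin 24} (h1 : q.1 = P24 s) :
    ∀ i, ∃ l, ε (rowOf s i) i l ≠ 0 :=
  fun i => ⟨q.2 i, by rw [rowOf_P24, ← h1]; exact present_of_termSign_ne_zero ε q hq i⟩

end Design

end Summit.ValiantsHypothesis.ValiantsHypothesis.Theorems.KPlusLogSqLaw.StaticFourQuad
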